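import Summits.AtomisticToContinuum.HydrodynamicLimit.Theorems.TwoClocksClampedWindowDockTimeZero
import Summits.AtomisticToContinuum.HydrodynamicLimit.Theorems.TwoClocksClampedWindowDockReferenceLLN
import Summits.AtomisticToContinuum.HydrodynamicLimit.Theorems.ImplosionDichotomyPolynomialCompressionEosRatioAnalytic

/-!
# Crux `TwoClocks.ClampedEntropyClock` (stmt-AtomisticToContinuum-15145), line `IdeatorTwoSketch`, stub S7c: the time-`0` member of the explicit reference family IS the initial law

Along Yau's relative-entropy clock the reference family is the EXPLICIT one-parameter family of
canonical local Gibbs laws `ψ_s = localGibbsLaw σ (ρ_s · Rf(σ³ρ_s)) (u s) (θ s)`, `Rf` the insertion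
factor of the hard-sphere gas (handed over by its four defining properties, as in
`EntropyClockDock.clampedWindowDock_of_gronwallRf`). This file proves that for small `σ` its
time-`0` member is the initial local Gibbs law `localGibbsLaw σ a₀ u₀ θ₀` itself, for EVERY `N`
(so the clock starts at zero relative entropy), in three static steps:

1. DATA PINNING (`EntropyClockDock.tie_rhoLim_of_smallDensity`, `EntropyClockDock.data_eq_of_ties`):
   in the statics regime `SmallDensity (profileOf a₀) σ` the local Gibbs laws of `(a₀, u₀, θ₀)` are
   tied to `(rhoLim (profileOf a₀) σ, u₀, θ₀)`, so a classical solution tied to them at `t = 0`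
   has `(ρ 0, u 0, θ 0) = (rhoLim (profileOf a₀) σ, u₀, θ₀)`;
2. ACTIVITY IDENTIFICATION UP TO SCALE (`rhoLim_mul_Rf_eq`): the EOS identity
   `rhoLim Q σ x · Rf(σ³ rhoLim Q σ x) = R · Q.β x` (`Q = profileOf a₀`, `R = ratioLimit Q σ`,
   `Q.β = a₀/∫a₀`), by the uniqueness of the root of `R' Φ(x R') = 1` in `[1/2, 2]`
   (`Φ(u) = Σ_j bE j uʲ/j!` the insertion series) — the `hrep` block of
   `EntropyClockDock.activity_of_density`, re-run here;
3. SCALE INVARIANCE of the canonical law (`localGibbsLaw_const_mul`): the factor `c^(N+1)` of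
   `tensorPow` cancels against the one of `canonicalPartition`.

Worker file for the registered stub `stub_timeZeroReference` of the lead skeleton
(`--supports stmt-AtomisticToContinuum-15145`). Imports: parts I and III of the dock helpers
(Literature + this route's Theses only) and the insertion-series constants `bE_zero`,
`abs_bE_div_factorial_le` of `ImplosionDichotomyPolynomialCompressionEosRatioAnalytic` (imported by part II
of the dock helpers as well; no other route's Theses module is reached). The scale invariance of §3 is
re-proved privately (same statements exist in `Theorems/KineticWindowGronwall/Negative/ActivityDummy.lean`
and `Theorems/CollisionIsometryCLTMacroClosureStubLedgerScaling.lean`, whose imports reach the Theses of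
route AntiMazurCoboundaries).
-/

noncomputable section

namespace Summit.AtomisticToContinuum.HydrodynamicLimit.Theorems.QuenchedCellClock

open MeasureTheory Set Filter Topology
open Literature.MathematicalPhysics.KineticTheory Literature.Analysis.FluidPDE
open Summit.AtomisticToContinuum.HydrodynamicLimit.Theorems.EntropyClockDock

/-! ### §1 The insertion series `Φ(u) = Σ_j bE j uʲ/j!` and the cluster series (PRIVATE re-proofs) -/

-- adapted from `EntropyClockDock.abs_phi_term_le` (Theorems/TwoClocksClampedWindowDockActivityInversion.lean),
-- itself from `R2OneModeTwoConditions.abs_phi_term_le`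
/-- Termwise bound of the insertion series at `0 ≤ u ≤ 2Mσ³`: `|bE j uʲ/j!| ≤ e θʲ`, `θ = geomRatio P σ`.
[folklore] -/
private theorem abs_phi_term_le {P : DensityProfile} {σ : ℝ} {u : ℝ} (hu0 : 0 ≤ u)
    (hu : u ≤ 2 * P.M * σ ^ 3) (j : ℕ) :
    |bE j / (j.factorial : ℝ) * u ^ j| ≤ Real.exp 1 * geomRatio P σ ^ j := by
  rw [abs_mul, abs_pow, abs_of_nonneg hu0]
  have hb := EosRatioAnalytic.abs_bE_div_factorial_le j
  have he : 0 < Real.exp 1 := Real.exp_pos 1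
  have hv := v₁_pos
  have hθ : Real.exp 1 * v₁ * u ≤ geomRatio P σ := by
    rw [geomRatio, ovDensity]
    calc Real.exp 1 * v₁ * u ≤ Real.exp 1 * v₁ * (2 * P.M * σ ^ 3) :=
          mul_le_mul_of_nonneg_left hu (by positivity)
      _ = 2 * Real.exp 1 * (P.M * v₁ * σ ^ 3) := by ring
  have h0 : 0 ≤ Real.exp 1 * v₁ * u := by positivity
  calc |bE j / (j.factorial : ℝ)| * u ^ j ≤ Real.exp 1 * (Real.exp 1 * v₁) ^ j * u ^ j := by gcongr
    _ = Real.exp 1 * (Real.exp 1 * v₁ * u) ^ j := by rw [mul_pow]; ring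
    _ ≤ Real.exp 1 * geomRatio P σ ^ j := by gcongr

-- adapted from `EntropyClockDock.abs_phi_sub_one_le` (ibid.)
/-- The insertion series is close to `1`: `|Φ(u) - 1| ≤ eθ/(1-θ)` for `0 ≤ u ≤ 2Mσ³` under `SmallDensity P σ`.
[folklore] -/
private theorem abs_phi_sub_one_le {P : DensityProfile} {σ : ℝ} (h : SmallDensity P σ) {u : ℝ}
    (hu0 : 0 ≤ u) (hu : u ≤ 2 * P.M * σ ^ 3) :
    |(∑' j : ℕ, bE j / (j.factorial : ℝ) * u ^ j) - 1| ≤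
      Real.exp 1 * geomRatio P σ / (1 - geomRatio P σ) := by
  have hθ0 := h.geomRatio_nonneg
  have hθ1 := h.geomRatio_lt_one
  have hsum : Summable fun j : ℕ => bE j / (j.factorial : ℝ) * u ^ j :=
    Summable.of_norm_bounded ((summable_geometric_of_lt_one hθ0 hθ1).mul_left _) fun j =>
      (Real.norm_eq_abs _).trans_le (abs_phi_term_le hu0 hu j)
  rw [hsum.tsum_eq_zero_add, EosRatioAnalytic.bE_zero, Nat.factorial_zero, Nat.cast_one, div_one, pow_zero,
    mul_one, add_sub_cancel_left]
  have hgeo : HasSum (fun j : ℕ => Real.exp 1 * geomRatio P σ ^ (j + 1))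
      (Real.exp 1 * geomRatio P σ / (1 - geomRatio P σ)) := by
    have h' := (hasSum_geometric_of_lt_one hθ0 hθ1).mul_left (Real.exp 1 * geomRatio P σ)
    rw [div_eq_mul_inv]
    refine h'.congr_fun fun j => ?_
    rw [pow_succ]; ring
  refine (Real.norm_eq_abs _).symm.trans_le (tsum_of_norm_bounded hgeo fun j => ?_)
  exact (Real.norm_eq_abs _).trans_le (abs_phi_term_le hu0 hu (j + 1))

-- adapted from `EntropyClockDock.rhoLim_eq_mul_phi` (ibid.)
/-- **The cluster series through the insertion series**: `rhoLim P σ x = R β(x) Φ(σ³ R β(x))`,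
`R = ratioLimit P σ` (termwise: `γ_j R^{j+1} β^{j+1} = Rβ · bE j (σ³Rβ)ʲ/j!`). [folklore] -/
private theorem rhoLim_eq_mul_phi (P : DensityProfile) (σ : ℝ) (x : T3) :
    rhoLim P σ x = ratioLimit P σ * P.β x *
      ∑' j : ℕ, bE j / (j.factorial : ℝ) * (σ ^ 3 * ratioLimit P σ * P.β x) ^ j := by
  rw [rhoLim, ← tsum_mul_left]
  refine tsum_congr fun j => ?_
  rw [clusterCoeff, mul_pow, mul_pow]
  ring

/-! ### §2 Activity identification up to scale: the EOS identity for `rhoLim` -/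

-- adapted from the `hrep` block of `EntropyClockDock.activity_of_density`
-- (Theorems/TwoClocksClampedWindowDockActivityInversion.lean)
/-- **EOS identity.** Let `Rf` be the unique root in `[1/2, 2]` of `R' Φ(x R') = 1` for `x ∈ (-r, r)`. In the
statics regime `SmallDensity Q σ` with `3 Q.M σ³ < r`, the limit density is positive and
`rhoLim Q σ x · Rf(σ³ rhoLim Q σ x) = ratioLimit Q σ · Q.β x` for every `x`: writing
`u = σ³ R β(x)`, `rhoLim = R β Φ(u)` with `Φ(u) ∈ (1/2, 3/2)`, and `Φ(u)⁻¹` is a root in `[1/2, 2]` at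
the point `σ³ rhoLim = u Φ(u)`, hence equals `Rf(σ³ rhoLim)`. [folklore] -/
theorem rhoLim_mul_Rf_eq {r : ℝ} {Rf : ℝ → ℝ}
    (huniq : ∀ x ∈ Set.Ioo (-r) r, ∀ R ∈ Set.Icc (1 / 2 : ℝ) 2,
      R * (∑' j : ℕ, bE j / (j.factorial : ℝ) * (x * R) ^ j) = 1 → R = Rf x)
    {Q : DensityProfile} {σ : ℝ} (hQs : SmallDensity Q σ) (h3r : 3 * Q.M * σ ^ 3 < r) (x : T3) :
    0 < rhoLim Q σ x ∧ rhoLim Q σ x * Rf (σ ^ 3 * rhoLim Q σ x) = ratioLimit Q σ * Q.β x := by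
  set R := ratioLimit Q σ with hRdef
  have hR := hQs.ratioLimit_mem
  have hR0 := hQs.ratioLimit_pos
  have hσ3 : 0 < σ ^ 3 := pow_pos hQs.σ_pos 3
  have hM0 := Q.M_pos
  set u := σ ^ 3 * R * Q.β x with hu
  set Φu := ∑' j : ℕ, bE j / (j.factorial : ℝ) * u ^ j with hΦu
  have hβ0 : 0 < Q.β x := Q.pos x
  have hu0 : 0 ≤ u := by positivity
  have huM : u ≤ 2 * Q.M * σ ^ 3 := by
    have h1 : R * Q.β x ≤ 2 * Q.M := mul_le_mul hR.2 (Q.le_M x) hβ0.le zero_le_two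
    calc u = σ ^ 3 * (R * Q.β x) := by rw [hu]; ring
      _ ≤ σ ^ 3 * (2 * Q.M) := by gcongr
      _ = 2 * Q.M * σ ^ 3 := by ring
  have hΦ1 := abs_phi_sub_one_le hQs hu0 huM
  rw [← hΦu, abs_le] at hΦ1
  have hφ := hQs.phi_lt_half
  have hΦlo : 1 / 2 < Φu := by linarith [hΦ1.1]
  have hΦhi : Φu < 3 / 2 := by linarith [hΦ1.2]
  have hΦpos : 0 < Φu := by linarith
  have hΦmem : Φu⁻¹ ∈ Set.Icc (1 / 2 : ℝ) 2 := by
    constructor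
    · rw [le_inv_comm₀ (by norm_num) hΦpos]; linarith
    · rw [inv_le_comm₀ hΦpos (by norm_num)]; linarith
  have hn : rhoLim Q σ x = R * Q.β x * Φu := rhoLim_eq_mul_phi Q σ x
  have hnσ : rhoLim Q σ x * σ ^ 3 = u * Φu := by rw [hn, hu]; ring
  have hnpos : 0 < rhoLim Q σ x := by rw [hn]; positivity
  have hmem : σ ^ 3 * rhoLim Q σ x ∈ Set.Ioo (-r) r := by
    refine ⟨?_, ?_⟩
    · have := mul_pos hσ3 hnpos
      linarith
    · rw [mul_comm, hnσ]
      calc u * Φu ≤ 2 * Q.M * σ ^ 3 * (3 / 2) := mul_le_mul huM hΦhi.le hΦpos.le (by positivity)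
        _ = 3 * Q.M * σ ^ 3 := by ring
        _ < r := h3r
  -- uniqueness of the root: `Rf (σ³ rhoLim) = Φ(u)⁻¹`
  have hRf : Φu⁻¹ = Rf (σ ^ 3 * rhoLim Q σ x) := by
    refine huniq _ hmem _ hΦmem ?_
    rw [mul_comm (σ ^ 3) (rhoLim Q σ x), hnσ,
      show u * Φu * Φu⁻¹ = u from mul_inv_cancel_right₀ hΦpos.ne' u, ← hΦu]
    exact inv_mul_cancel₀ hΦpos.ne'
  refine ⟨hnpos, ?_⟩
  rw [← hRf, hn, mul_assoc, mul_inv_cancel₀ hΦpos.ne', mul_one]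

/-! ### §3 Scale invariance of the canonical local Gibbs law -/

-- adapted from `KineticWindowGronwallNegative.tensorPow_const_mul`
-- (Theorems/KineticWindowGronwall/Negative/ActivityDummy.lean; also Cruxes/KineticWindowGronwall/Disproof.lean §7)
/-- Tensor powers are multiplicative in a constant factor. [folklore] -/
private theorem tensorPow_const_mul {n : ℕ} (c : ℝ) (f : T3 × V3 → ℝ) :
    tensorPow n (fun y => c * f y) = fun z : Config n (Fin 3) T3 => c ^ n * tensorPow n f z := by
  funext z
  simp [tensorPow, Finset.prod_mul_distrib, Finset.prod_const]

-- adapted from `KineticWindowGronwallNegative.canonicalDensity_const_mul` (ibid.)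
/-- The canonical density does not see a non-zero constant factor in the one-particle profile (it cancels
against the partition function; if the partition function vanishes both sides are the junk `0`). [folklore] -/
private theorem canonicalDensity_const_mul {n : ℕ} {c : ℝ} (hc : c ≠ 0) (ε : ℝ) (f : T3 × V3 → ℝ)
    (z : Config n (Fin 3) T3) :
    canonicalDensity (Torus.geometry (Fin 3)) ε n (fun y => c * f y) z =
      canonicalDensity (Torus.geometry (Fin 3)) ε n f z := by
  set D := hardSphereDomain (Torus.geometry (Fin 3)) n ε with hD
  have hind : D.indicator (tensorPow n (fun y => c * f y)) =
      fun z => c ^ n * D.indicator (tensorPow n f) z := by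
    funext w
    rw [tensorPow_const_mul]
    by_cases hw : w ∈ D <;> simp [hw]
  have hZ : canonicalPartition (Torus.geometry (Fin 3)) ε n (fun y => c * f y) =
      c ^ n * canonicalPartition (Torus.geometry (Fin 3)) ε n f := by
    simp only [canonicalPartition, ← hD, hind]
    exact integral_const_mul _ _
  have hcn : (c ^ n)⁻¹ * c ^ n = 1 := inv_mul_cancel₀ (pow_ne_zero n hc)
  simp only [canonicalDensity, ← hD, hZ, hind]
  calc (c ^ n * canonicalPartition (Torus.geometry (Fin 3)) ε n f)⁻¹ * (c ^ n * D.indicator (tensorPow n f) z)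
      = ((c ^ n)⁻¹ * c ^ n) * ((canonicalPartition (Torus.geometry (Fin 3)) ε n f)⁻¹ *
          D.indicator (tensorPow n f) z) := by rw [mul_inv]; ring
    _ = _ := by rw [hcn, one_mul]

-- adapted from `MacroClosureLine.StubLedger.localGibbsProfile_const_mul` / `localGibbsLaw_const_mul`
-- (Theorems/CollisionIsometryCLTMacroClosureStubLedgerScaling.lean)
/-- Scaling the activity scales the local Gibbs profile: `prof_{c a} = c · prof_a`. [folklore] -/
private theorem localGibbsProfile_const_mul (c : ℝ) (a θ : T3 → ℝ) (u : T3 → V3) :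
    localGibbsProfile (fun x => c * a x) u θ = fun y => c * localGibbsProfile a u θ y := by
  funext y
  simp [localGibbsProfile, mul_assoc]

/-- **Scale invariance.** The canonical local Gibbs law is invariant under scaling of the activity by a
positive constant (the factor `c^(N+1)` of the tensor power cancels against the partition function).
(Same statement as `MacroClosureLine.StubLedger.localGibbsLaw_const_mul`; private re-proof keeping the
imports of this file within those of the dock helpers `TwoClocksClampedWindowDock*`.) [folklore] -/
private theorem localGibbsLaw_const_mul {σ : ℝ} {N : ℕ}
    (Φ : HardSphereFlow (Torus.geometry (Fin 3)) (hsDiameter σ N) (N + 1)) (a θ : T3 → ℝ)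
    (u : T3 → V3) {c : ℝ} (hc : 0 < c) :
    localGibbsLaw σ (fun x => c * a x) u θ N Φ = localGibbsLaw σ a u θ N Φ := by
  unfold localGibbsLaw
  rw [localGibbsProfile_const_mul]
  congr 1
  funext z
  exact canonicalDensity_const_mul hc.ne' _ _ z

/-! ### §4 The stub -/

/-- **Stub S7c — the time-`0` member of the explicit reference family IS the initial law.**
For an insertion factor `Rf` on `(-r, r)` (its four defining properties handed over, as in
`clampedWindowDock_of_gronwallRf`; only the uniqueness of the root is used) and continuous positive
profiles, at small `σ`: if a classical solution on `[0, T)`, `T > 0`, is tied to the local Gibbs data at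
`t = 0`, then `(ρ 0, u 0, θ 0)` is the data's LLN limit (`data_eq_of_ties`, `tie_rhoLim_of_smallDensity`),
the activity `ρ_0 · Rf(σ³ρ_0)` is the positive multiple `(ratioLimit Q σ / ∫a₀) · a₀` of `a₀`
(`rhoLim_mul_Rf_eq`, `Q = profileOf a₀`), and the canonical local Gibbs law is invariant under that scale
(`localGibbsLaw_const_mul`) — so the two laws coincide for every `N`. The threshold is
`σ₀ = min σ₁ (r / (3 Q.M))`, `σ₁` the statics threshold of `exists_smallDensity Q`. [folklore] -/
theorem stub_timeZeroReference {r : ℝ} {Rf : ℝ → ℝ} (hr : 0 < r)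
    (_hsol : ∀ x ∈ Set.Ioo (-r) r, 0 < Rf x ∧ Rf x * (∑' j : ℕ, bE j / (j.factorial : ℝ) * (x * Rf x) ^ j) = 1)
    (_hbd : ∀ x ∈ Set.Icc 0 r, 1 ≤ Rf x ∧ Rf x ≤ 2) (_hcont : ContinuousOn Rf (Set.Icc 0 r))
    (huniq : ∀ x ∈ Set.Ioo (-r) r, ∀ R ∈ Set.Icc (1 / 2 : ℝ) 2,
      R * (∑' j : ℕ, bE j / (j.factorial : ℝ) * (x * R) ^ j) = 1 → R = Rf x)
    (a₀ θ₀ : T3 → ℝ) (u₀ : T3 → V3) (ha : Continuous a₀) (hθ : Continuous θ₀) (hu : Continuous u₀)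
    (ha0 : ∀ x, 0 < a₀ x) (hθ0 : ∀ x, 0 < θ₀ x) :
    ∃ σ₀ : ℝ, 0 < σ₀ ∧ ∀ σ : ℝ, 0 < σ → σ < σ₀ →
      ∀ (T : ℝ) (ρ θ : ℝ → T3 → ℝ) (u : ℝ → T3 → V3), IsHardSphereEulerSolution σ T ρ u θ → 0 < T →
        ∀ Φ : (N : ℕ) → HardSphereFlow (Torus.geometry (Fin 3)) (hsDiameter σ N) (N + 1),
          TendstoHydroFieldsAt (fun N => localGibbsLaw σ a₀ u₀ θ₀ N (Φ N)) Φ ρ u θ 0 →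
          ∀ N : ℕ, localGibbsLaw σ (fun x => ρ 0 x * Rf (σ ^ 3 * ρ 0 x)) (u 0) (θ 0) N (Φ N) =
            localGibbsLaw σ a₀ u₀ θ₀ N (Φ N) := by
  set Q := profileOf a₀ ha ha0 with hQ
  have hM0 := Q.M_pos
  have hI : 0 < ∫ y, a₀ y := integral_pos_of_continuous_pos ha ha0
  -- the statics threshold of the profile
  obtain ⟨σ₁, hσ₁, hsmall⟩ := exists_smallDensity Q one_pos
  refine ⟨min σ₁ (r / (3 * Q.M)), lt_min hσ₁ (by positivity), ?_⟩
  intro σ hσ hσlt T ρ θ u hE hT Φ htie N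
  have hσ₁' : σ < σ₁ := hσlt.trans_le (min_le_left _ _)
  have hσr : σ < r / (3 * Q.M) := hσlt.trans_le (min_le_right _ _)
  have hQs : SmallDensity Q σ := (hsmall σ hσ hσ₁').1
  have hσ2 : σ ≤ 1 / 2 := hQs.σ_lt_half.le
  -- the range condition `3 Q.M σ³ < r` of the EOS identity
  have h3r : 3 * Q.M * σ ^ 3 < r := by
    have h31 : σ ^ 3 ≤ σ := pow_le_of_le_one hσ.le (hσ2.trans (by norm_num)) three_ne_zero
    have h3M : 0 < 3 * Q.M := by positivity
    calc 3 * Q.M * σ ^ 3 ≤ 3 * Q.M * σ := mul_le_mul_of_nonneg_left h31 h3M.le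
      _ < 3 * Q.M * (r / (3 * Q.M)) := mul_lt_mul_of_pos_left hσr h3M
      _ = r := mul_div_cancel₀ r h3M.ne'
  -- step 2: the EOS identity, `rhoLim Q σ · Rf(σ³ rhoLim Q σ) = (R/∫a₀) · a₀`, and `rhoLim Q σ > 0`
  have hrep := rhoLim_mul_Rf_eq huniq hQs h3r
  have hρ₀pos : ∀ x, 0 < rhoLim Q σ x := fun x => (hrep x).1
  have hfun : (fun x => rhoLim Q σ x * Rf (σ ^ 3 * rhoLim Q σ x)) =
      fun x => ratioLimit Q σ / (∫ y, a₀ y) * a₀ x := by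
    funext x
    rw [(hrep x).2, hQ, profileOf_β]
    ring
  have hc : 0 < ratioLimit Q σ / ∫ y, a₀ y := div_pos hQs.ratioLimit_pos hI
  -- step 1: data pinning at `t = 0`
  have h0 : (0 : ℝ) ∈ Set.Ico 0 T := ⟨le_rfl, hT⟩
  obtain ⟨hρ, hu', hθ'⟩ := data_eq_of_ties hσ2 Φ ha hθ hu ha0 hθ0 hQs.continuous_rhoLim hρ₀pos
    (tie_rhoLim_of_smallDensity ha hθ hu ha0 hθ0 hσ2 hQs Φ)
    (hE.smooth_density.isSmooth_slice h0).continuous (hE.smooth_velocity.isSmooth_slice h0).continuous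
    (hE.smooth_temperature.isSmooth_slice h0).continuous htie
  -- step 3: scale invariance
  rw [hρ, hu', hθ', hfun]
  exact localGibbsLaw_const_mul (Φ N) a₀ θ₀ u₀ hc

end Summit.AtomisticToContinuum.HydrodynamicLimit.Theorems.QuenchedCellClock

end
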